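import Literature.AlgebraicGeometry.HodgeTheory.FermatConeSpanSelfTerm
import Literature.AlgebraicGeometry.HodgeTheory.GysinCleanBaseChange
import Literature.AlgebraicGeometry.HodgeTheory.DiagonalSymmetryGysinEquivariance
import Literature.AlgebraicGeometry.HodgeTheory.FermatSubvariety
import Literature.AlgebraicGeometry.HodgeTheory.FermatEigenspaceNonvanishing
import Literature.AlgebraicGeometry.HodgeTheory.DworkSexticFlatPiecesHodgeRiemannTransport
import Literature.AlgebraicGeometry.HodgeTheory.FermatJuxtapositionSpans
import HarnessLib

/-!
# The cone-span leaf (III-l) of Aoki's Thm. 1-4 (i) from a CONE DATUM: all cohomology discharged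

Family `hodge`, layer `Literature/AlgebraicGeometry/HodgeTheory`. PROOF FILE (theorems only; no
definition, no named fact). N. Aoki, J. Math. Soc. Japan 39 (1987), Thm. 1-4 (i) with `r = 0`
(p. 388; p. 386 "represents ⟹ claim"); T. Shioda, Math. Ann. 245 (1979), Thm. I; Z. Ran, Compositio
Math. 42 (1980), Prop. 1.14; G. da Silva Jr., arXiv:2101.04739, Thm. 2.2 (b): the completed cones over
the sub-Fermat variety `S = {x₀ = x₁ = 0} ≅ X²ˢₘ` of `X = X^{2s+2}ₘ` with vertices the points
`v_ε = (1 : ε : 0 : ⋯ : 0)`, `εᵐ = -1`, represent the juxtapositions `(c, -c) ∗ β`.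

The tree's named leaf `Shioda1979_coneSpan_represents_left` (`FermatJuxtapositionSpans`, (III-l)) asks,
for Hodge characters `α = (c, -c)` of `X⁰ₘ` and `β` of `X²ˢₘ`, for a span `S ←π— E —φ→ X` (`E` smooth
projective of dimension `2s + 1`, `π` flat) and a class `w ∈ V(β)` with `π_{α∗β}(φ_*π^* w) ≠ 0`. THIS
FILE proves that conclusion from a purely GEOMETRIC datum on the span — no cohomology is left to the
construction:

* (σ) a section `σ` of `π` which is a closed immersion;
* (stab) for every diagonal symmetry `a ∈ μₘ^{2s+4}` FIXING the vertex line ratio (`a₀ = a₁`) an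
  automorphism `g̃` of `E` (with inverse) such that `g̃ ≫ φ = φ ≫ g_a` and `g̃ ≫ π = π ≫ g_{a|S}`
  (the cone over `S` with vertex `v` is `g_a`-stable, compatibly with the projection);
* (inc) for every `a` MOVING the vertex (`a₀ ≠ a₁`) and trivial on the coordinates of `S`, the moved
  cone `g_a ∘ φ` meets `φ` only along the common section: `g_a(φ(P)) = φ(Q) ⟹ P = Q = σ(R)`;
* (h1) `φ^*(φ_* 1) ≠ 0` in `H²(E(ℂ); ℂ)` (the cone is a hyperplane section: `φ^* h ≠ 0`).

From these: `x = φ_*π^* w` (`w ∈ V(β)`, `w ≠ 0` by `Ran1980_fermatEigenspace_ne_bot`) is a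
`χ_{0∗β}`-eigenvector of the stabiliser (`g_a^*(φ_* y) = (φ ≫ g_{a⁻¹})_* y`,
`DiagonalSymmetryGysinEquivariance`; `g̃'_* = g̃^*` for an automorphism; `ι^* V ⊆ V(β)` bookkeeping
`fermatCharacter_append_zero`); off the stabiliser `a = a_s · p` with `p` a pure vertex move, and
`φ^*((φ ≫ g_{p⁻¹})_* π^* w) = K • σ_* w` with ONE `K ≠ 0` by the clean base change along a common section
(`complexGysin_baseChange_of_commonSection`, `GysinCleanBaseChange`; `K` does not depend on `p` because
`(φ ≫ g)_* 1 = φ_* 1` — the diagonal symmetries act trivially on `H²(X)`, Lefschetz,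
`map_diagonalMap_eq_self_of_surjective`); and the criterion WITHOUT self-term
(`fermatProjector_ne_zero_of_offStabilizer_restrictions`, `FermatConeSpanSelfTerm`) concludes
`π_{α∗β} x ≠ 0` with `Λ = φ^*`, `A = σ_* w ≠ 0` (`π_* σ_* = id`).

* `FermatCharacter.embFirst_or_embSecond`, `comp_embSecond_mem_fermatGroup`,
  `fermatCharacter_append_zero` — index and character bookkeeping for `r = 0`;
* `coneSpan_represents_of_coneDatum` — **the conclusion of (III-l) for `(m, s)` and all Hodge
  `α`, `β` from a cone datum**;
* `Shioda1979_coneSpan_represents_left_of_coneData` — **(III-l) itself from cone data for all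
  `m ≥ 1`, `s ≥ 1`**.

## References

* [Aoki1987] N. Aoki, Some new algebraic cycles on Fermat varieties, J. Math. Soc. Japan 39 (1987)
  385–396: Thm. 1-4 (i) p. 388, p. 386.
* [Shioda1979HodgeFermat] T. Shioda, The Hodge conjecture for Fermat varieties, Math. Ann. 245 (1979)
  175–184, §1 and Thm. I.
* [Ran1980] Z. Ran, Cycles on Fermat hypersurfaces, Compositio Math. 42 (1980), §1 Prop. 1.7 (i),
  Prop. 1.14.
* [daSilva2021HodgeFermat] G. da Silva Jr., Notes on the Hodge Conjecture for Fermat Varieties,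
  arXiv:2101.04739, Thm. 2.2 (b).
* [Fulton1998] W. Fulton, Intersection Theory, 2nd ed. 1998, Thm. 6.2 (a), §19.2.
* [VoisinHodgeII2003] C. Voisin, Hodge Theory and Complex Algebraic Geometry II, §1.2.3 Cor. 1.24.
-/

noncomputable section

open CategoryTheory AlgebraicGeometry Finset
open Literature.AlgebraicGeometry.Motives Literature.AlgebraicTopology.SingularHomology

namespace Literature.AlgebraicGeometry.HodgeTheory

variable {m s : ℕ}

/-! ### Index bookkeeping for the juxtaposition `(c, -c) ∗ β` (`r = 0`) -/

namespace FermatCharacter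

/-- Every coordinate of `X^{2(0+s+1)}ₘ` is either one of the two vertex slots (`embFirst 0 s`) or a
coordinate of the sub-Fermat variety `X²ˢₘ` (`embSecond 0 s`) — the two blocks of the juxtaposition
`α ∗ β`. [cite: Aoki1987, §1] [cite: daSilva2021HodgeFermat, Thm. 2.2] -/
theorem embFirst_or_embSecond (j : Fin (2 * (0 + s + 1) + 2)) :
    (∃ i, j = embFirst 0 s i) ∨ (∃ k, j = embSecond 0 s k) := by
  obtain ⟨j', rfl⟩ := (finCongr (two_mul_add_two 0 s)).symm.surjective j
  refine Fin.addCases (motive := fun j' ↦ (∃ i, (finCongr (two_mul_add_two 0 s)).symm j' = embFirst 0 s i) ∨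
      (∃ k, (finCongr (two_mul_add_two 0 s)).symm j' = embSecond 0 s k)) (fun i ↦ ?_) (fun k ↦ ?_) j'
  · exact Or.inl ⟨i, rfl⟩
  · exact Or.inr ⟨k, rfl⟩

/-- `append α β (embFirst i) = α i`. [cite: Aoki1987, §1] -/
theorem append_embFirst {r : ℕ} (α : Fin (2 * r + 2) → ZMod m) (β : Fin (2 * s + 2) → ZMod m)
    (i : Fin (2 * r + 2)) : append α β (embFirst r s i) = α i :=
  congrFun (append_comp_embFirst α β) i

/-- `append α β (embSecond k) = β k`. [cite: Aoki1987, §1] -/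
theorem append_embSecond {r : ℕ} (α : Fin (2 * r + 2) → ZMod m) (β : Fin (2 * s + 2) → ZMod m)
    (k : Fin (2 * s + 2)) : append α β (embSecond r s k) = β k :=
  congrFun (append_comp_embSecond α β) k

end FermatCharacter

open FermatCharacter (append embFirst embSecond)

/-- The restriction `a|S = a ∘ embSecond` of `a ∈ μₘ^{2s+4}` to the coordinates of the sub-Fermat
variety `X²ˢₘ = {x = 0}` lies in `μₘ^{2s+2}` (the symmetry group of `X²ˢₘ`; Shioda's `Gⁿₘ ⊃ Gˢₘ`).
[cite: Shioda1979PJA, §4] [cite: daSilva2021HodgeFermat, Thm. 2.2 (a)] -/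
theorem comp_embSecond_mem_fermatGroup (a : fermatGroup (2 * (0 + s + 1)) m) :
    (fun k ↦ (a : Fin (2 * (0 + s + 1) + 2) → ℂˣ) (embSecond 0 s k)) ∈ fermatGroup (2 * s) m :=
  mem_fermatGroup_iff.mpr fun _ ↦ mem_fermatGroup_iff.mp a.2 _

/-- **`χ_{0∗β}(a) = χ_β(a|S)`**: the character `(0, 0) ∗ β` (zero on the vertex slots) of `μₘ^{2s+4}`
is `χ_β` of the restriction to the coordinates of the sub-Fermat variety. [cite: Shioda1979PJA, §4] -/
theorem fermatCharacter_append_zero [NeZero m] (β : Fin (2 * s + 2) → ZMod m)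
    (a : fermatGroup (2 * (0 + s + 1)) m) :
    fermatCharacter m (append (0 : Fin (2 * 0 + 2) → ZMod m) β) a =
      fermatCharacter m β ⟨_, comp_embSecond_mem_fermatGroup a⟩ := by
  rw [fermatCharacter_apply, fermatCharacter_apply]
  change ∏ j, (a : Fin (2 * (0 + s + 1) + 2) → ℂˣ) j ^ (append (0 : Fin (2 * 0 + 2) → ZMod m) β j).val =
    ∏ k, (a : Fin (2 * (0 + s + 1) + 2) → ℂˣ) (embSecond 0 s k) ^ (β k).val
  rw [← Fintype.prod_equiv (finCongr (FermatCharacter.two_mul_add_two 0 s)).symm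
    (fun j' ↦ (a : Fin (2 * (0 + s + 1) + 2) → ℂˣ) ((finCongr (FermatCharacter.two_mul_add_two 0 s)).symm j') ^
      (append (0 : Fin (2 * 0 + 2) → ZMod m) β ((finCongr (FermatCharacter.two_mul_add_two 0 s)).symm j')).val)
    _ (fun _ ↦ rfl), Fin.prod_univ_add]
  have h1 : ∏ i : Fin (2 * 0 + 2), (a : Fin (2 * (0 + s + 1) + 2) → ℂˣ)
      ((finCongr (FermatCharacter.two_mul_add_two 0 s)).symm (Fin.castAdd (2 * s + 2) i)) ^
        (append (0 : Fin (2 * 0 + 2) → ZMod m) β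
          ((finCongr (FermatCharacter.two_mul_add_two 0 s)).symm (Fin.castAdd (2 * s + 2) i))).val = 1 := by
    refine Finset.prod_eq_one fun i _ ↦ ?_
    have : append (0 : Fin (2 * 0 + 2) → ZMod m) β
        ((finCongr (FermatCharacter.two_mul_add_two 0 s)).symm (Fin.castAdd (2 * s + 2) i)) = 0 :=
      FermatCharacter.append_embFirst (0 : Fin (2 * 0 + 2) → ZMod m) β i
    rw [this, ZMod.val_zero, pow_zero]
  rw [h1, one_mul]
  refine Finset.prod_congr rfl fun k _ ↦ ?_
  have : append (0 : Fin (2 * 0 + 2) → ZMod m) β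
      ((finCongr (FermatCharacter.two_mul_add_two 0 s)).symm (Fin.natAdd (2 * 0 + 2) k)) = β k :=
    FermatCharacter.append_embSecond (0 : Fin (2 * 0 + 2) → ZMod m) β k
  rw [this]
  rfl

/-! ### The cone span represents `(c, -c) ∗ β`, granted a cone datum -/

/-- **The conclusion of the cone-span leaf (III-l) from a cone datum.** Let `m, s ≥ 1`,
`S = X²ˢₘ`, `X = X^{2(0+s+1)}ₘ`, and let `S ←π— E —φ→ X` be a span of smooth projective varieties
(`dim E = 2s + 1`, `π` flat) with: (σ) a closed-immersion section `σ` of `π`; (stab) for every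
`a ∈ μₘ^{2s+4}` with `a₀ = a₁` (the two `embFirst` slots) an automorphism `g̃` of `E` with inverse,
`g̃ ≫ φ = φ ≫ g_a`, `g̃ ≫ π = π ≫ g_{a|S}`; (inc) for every `a` with `a₀ ≠ a₁` and `a|S = 1`,
`g_a(φ P) = φ Q` only for `P = Q = σ R`; (h1) `φ^*(φ_* 1) ≠ 0`. Then for all Hodge characters `α`
of `X⁰ₘ` and `β ∈ 𝔅²ˢₘ` there is `w ∈ V(β)` with `π_{α∗β}(φ_*(π^* w)) ≠ 0` (complex orientations).
Proof in the module docstring: eigenvector of the stabiliser, clean base change along the common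
section off it (one `K ≠ 0`, uniform by Lefschetz on `H²(X)`), and
`fermatProjector_ne_zero_of_offStabilizer_restrictions`.
[cite: Aoki1987, Thm. 1-4 (i) p. 388 and p. 386] [cite: Ran1980, §1 Prop. 1.14]
[cite: Shioda1979HodgeFermat, Thm. I] [cite: Fulton1998, Thm. 6.2 (a) and §19.2]
[cite: VoisinHodgeII2003, §1.2.3 Cor. 1.24] -/
theorem coneSpan_represents_of_coneDatum [NeZero m] (hs : 1 ≤ s)
    {E : SchemeOver ℂ} (hE : IsSmoothProjective (2 * s + 1) E)
    (hX : IsSmoothProjective (2 * (0 + s + 1)) (fermatHypersurface (2 * (0 + s + 1)) m))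
    (π : E ⟶ fermatHypersurface (2 * s) m)
    (σ : fermatHypersurface (2 * s) m ⟶ E) (hσπ : σ ≫ π = 𝟙 _) [IsClosedImmersion σ.left]
    (φ : E ⟶ fermatHypersurface (2 * (0 + s + 1)) m)
    (hstab : ∀ a : fermatGroup (2 * (0 + s + 1)) m,
      (a : Fin (2 * (0 + s + 1) + 2) → ℂˣ) (embFirst 0 s 0) =
        (a : Fin (2 * (0 + s + 1) + 2) → ℂˣ) (embFirst 0 s 1) →
      ∃ g g' : E ⟶ E, g ≫ g' = 𝟙 E ∧ g' ≫ g = 𝟙 E ∧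
        g ≫ φ = φ ≫ diagonalAut (fermatPolynomial ℂ (2 * (0 + s + 1)) m)
          (fermatGroup_le_diagonalStabilizer m a.2) ∧
        g ≫ π = π ≫ diagonalAut (fermatPolynomial ℂ (2 * s) m)
          (fermatGroup_le_diagonalStabilizer m (comp_embSecond_mem_fermatGroup a)))
    (hinc : ∀ a : fermatGroup (2 * (0 + s + 1)) m,
      (a : Fin (2 * (0 + s + 1) + 2) → ℂˣ) (embFirst 0 s 0) ≠
        (a : Fin (2 * (0 + s + 1) + 2) → ℂˣ) (embFirst 0 s 1) →
      (∀ k, (a : Fin (2 * (0 + s + 1) + 2) → ℂˣ) (embSecond 0 s k) = 1) →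
      ∀ P Q : ComplexPoints E,
        AlgPoints.map (φ ≫ diagonalAut (fermatPolynomial ℂ (2 * (0 + s + 1)) m)
          (fermatGroup_le_diagonalStabilizer m a.2)) P = AlgPoints.map φ Q →
        ∃ R : ComplexPoints (fermatHypersurface (2 * s) m), AlgPoints.map σ R = P ∧ AlgPoints.map σ R = Q)
    (h1 : complexBetti.map φ 2 (complexGysin complexOrientationFamily hE hX φ
      (show 0 + 2 * (2 * (0 + s + 1)) = 2 + 2 * (2 * s + 1) by omega)
      (singularCohomology.one ℂ (ComplexPoints E))) ≠ 0)
    {α : Fin (2 * 0 + 2) → ZMod m} {β : Fin (2 * s + 2) → ZMod m}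
    (hα : FermatCharacter.IsHodge α) (hβ : FermatCharacter.IsHodge β) :
    ∃ w ∈ fermatEigenspace m β (2 * s),
      fermatProjector m (append α β) (2 * (0 + s + 1))
        (complexGysin complexOrientationFamily hE hX φ
          (show 2 * s + 2 * (2 * (0 + s + 1)) = 2 * (0 + s + 1) + 2 * (2 * s + 1) by omega)
          (complexBetti.map π (2 * s) w)) ≠ 0 := by
  classical
  -- ## notation and basic facts
  have hm : 1 ≤ m := NeZero.one_le
  have hμ : complexOrientationFamily.HasPoincareDuality := hasPoincareDuality_complexOrientationFamily
  have hS : IsSmoothProjective (2 * s) (fermatHypersurface (2 * s) m) :=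
    isSmoothProjective_fermatHypersurface (by omega) hm
  have hdegσ : 2 * s + 2 * (2 * s + 1) = 2 * (0 + s + 1) + 2 * (2 * s) := by omega
  have hdegπ : 2 * (0 + s + 1) + 2 * (2 * s) = 2 * s + 2 * (2 * s + 1) := by omega
  have hdegφ : 2 * s + 2 * (2 * (0 + s + 1)) = 2 * (0 + s + 1) + 2 * (2 * s + 1) := by omega
  have hdeg0 : 0 + 2 * (2 * (0 + s + 1)) = 2 + 2 * (2 * s + 1) := by omega
  -- ## a non-zero class `w ∈ V(β)`
  obtain ⟨w, hwV, hw0⟩ : ∃ w ∈ fermatEigenspace m β (2 * s), w ≠ 0 := by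
    have h := Ran1980_fermatEigenspace_ne_bot m s β hs hβ.1.1 hβ.1.2
    rwa [ne_eq, ← ne_eq, Submodule.ne_bot_iff] at h
  refine ⟨w, hwV, ?_⟩
  -- `1_S ≠ 0` (as `w = w ⌣ 1 ≠ 0`)
  have h1S : singularCohomology.one ℂ (ComplexPoints (fermatHypersurface (2 * s) m)) ≠ 0 := by
    intro h0
    apply hw0
    rw [← cupProduct_one w, h0, map_zero]
  -- ## `π_* σ_* = id`, so `σ_*` is injective
  have hπσ : ∀ {a b : ℕ} (hab : a + 2 * (2 * s + 1) = b + 2 * (2 * s)) (hba : b + 2 * (2 * s) = a + 2 * (2 * s + 1))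
      (y : complexBetti (fermatHypersurface (2 * s) m) a),
      complexGysin complexOrientationFamily hE hS π hba (complexGysin complexOrientationFamily hS hE σ hab y) = y := by
    intro a b hab hba y
    have hcomp := complexGysin_comp hμ hS hE hS σ π hab hba
    rw [hσπ, complexGysin_id hμ hS] at hcomp
    have := congrArg (fun f ↦ f y) hcomp
    simpa using this.symm
  have hA : complexGysin complexOrientationFamily hS hE σ hdegσ w ≠ 0 := by
    intro h0
    apply hw0
    rw [← hπσ hdegσ hdegπ w, h0, map_zero]
  have hσ1 : complexGysin complexOrientationFamily hS hE σ
      (show 0 + 2 * (2 * s + 1) = 2 + 2 * (2 * s) by omega)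
      (singularCohomology.one ℂ (ComplexPoints (fermatHypersurface (2 * s) m))) ≠ 0 := by
    intro h0
    apply h1S
    rw [← hπσ (show 0 + 2 * (2 * s + 1) = 2 + 2 * (2 * s) by omega)
      (show 2 + 2 * (2 * s) = 0 + 2 * (2 * s + 1) by omega) (singularCohomology.one ℂ _), h0, map_zero]
  -- ## the vertex slots and the characters `δ = α ∗ β`, `δ' = 0 ∗ β`
  have h01 : (embFirst 0 s 0 : Fin (2 * (0 + s + 1) + 2)) ≠ embFirst 0 s 1 := fun h ↦
    absurd ((embFirst 0 s).injective h) (by decide)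
  have hδ0 : append α β (embFirst 0 s 0) ≠ 0 := by
    rw [FermatCharacter.append_embFirst]; exact hα.1.1 0
  have hsum : append α β (embFirst 0 s 0) + append α β (embFirst 0 s 1) = 0 := by
    rw [FermatCharacter.append_embFirst, FermatCharacter.append_embFirst]
    have h := hα.1.2
    rwa [Fin.sum_univ_two] at h
  have hδ'0 : append (0 : Fin (2 * 0 + 2) → ZMod m) β (embFirst 0 s 0) = 0 := by
    rw [FermatCharacter.append_embFirst]; rfl
  have hδ'1 : append (0 : Fin (2 * 0 + 2) → ZMod m) β (embFirst 0 s 1) = 0 := by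
    rw [FermatCharacter.append_embFirst]; rfl
  have hδ'j : ∀ j, j ≠ embFirst 0 s 0 → j ≠ embFirst 0 s 1 →
      append (0 : Fin (2 * 0 + 2) → ZMod m) β j = append α β j := by
    intro j hj0 hj1
    rcases FermatCharacter.embFirst_or_embSecond j with ⟨i, rfl⟩ | ⟨k, rfl⟩
    · exfalso
      fin_cases i
      · exact hj0 rfl
      · exact hj1 rfl
    · rw [FermatCharacter.append_embSecond, FermatCharacter.append_embSecond]
  have hδ'ne : append (0 : Fin (2 * 0 + 2) → ZMod m) β ≠ 0 := by
    intro h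
    have h' := congrFun h (embSecond 0 s 0)
    rw [FermatCharacter.append_embSecond, Pi.zero_apply] at h'
    exact hβ.1.1 0 h'
  -- ## Lefschetz: the diagonal symmetries act trivially on `H²(X)`, so `(φ ≫ g_a)_* 1 = φ_* 1`
  have hsurj2 : Function.Surjective
      (complexBetti.map (SmoothHypersurface.hypersurfaceι (fermatPolynomial ℂ (2 * (0 + s + 1)) m)) 2) :=
    surjective_map_hypersurfaceι_of_lt (isSmoothHypersurface_fermatHypersurface (by omega) hm)
      (isHomogeneous_fermatPolynomial _ m) (irreducible_fermatPolynomial_of_isAlgClosed (by omega) hm)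
      (by omega)
  have hone : ∀ a : fermatGroup (2 * (0 + s + 1)) m,
      complexGysin complexOrientationFamily hE hX
          (φ ≫ diagonalAut (fermatPolynomial ℂ (2 * (0 + s + 1)) m) (fermatGroup_le_diagonalStabilizer m a.2))
          hdeg0 (singularCohomology.one ℂ (ComplexPoints E)) =
        complexGysin complexOrientationFamily hE hX φ hdeg0 (singularCohomology.one ℂ (ComplexPoints E)) := by
    intro a
    have ha' := fermatGroup_le_diagonalStabilizer m a.2
    rw [← complexBetti_map_complexGysin_of_comp_eq_id hX hX
      (diagonalAut (fermatPolynomial ℂ (2 * (0 + s + 1)) m) (inv_mem ha'))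
      (diagonalAut (fermatPolynomial ℂ (2 * (0 + s + 1)) m) ha')
      (diagonalAut_comp_inv _ ha') (isBirational_diagonalAut_left _ ha') hE φ hdeg0]
    exact map_diagonalMap_eq_self_of_surjective (inv_mem ha') hsurj2 _
  -- ## the clean base change along the common section, for every pure vertex move `q`
  have hK : ∀ q : fermatGroup (2 * (0 + s + 1)) m,
      (q : Fin (2 * (0 + s + 1) + 2) → ℂˣ) (embFirst 0 s 0) ≠
        (q : Fin (2 * (0 + s + 1) + 2) → ℂˣ) (embFirst 0 s 1) →
      (∀ k, (q : Fin (2 * (0 + s + 1) + 2) → ℂˣ) (embSecond 0 s k) = 1) →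
      ∃ K : ℂ, K ≠ 0 ∧ ∀ ⦃a b : ℕ⦄ (hab : a + 2 * (2 * (0 + s + 1)) = b + 2 * (2 * s + 1))
        (w' : complexBetti (fermatHypersurface (2 * s) m) a),
        complexBetti.map φ b (complexGysin complexOrientationFamily hE hX
            (φ ≫ diagonalAut (fermatPolynomial ℂ (2 * (0 + s + 1)) m)
              (fermatGroup_le_diagonalStabilizer m q.2)) hab (complexBetti.map π a w')) =
          K • complexGysin complexOrientationFamily hS hE σ
            (show a + 2 * (2 * s + 1) = b + 2 * (2 * s) by omega) w' :=
    fun q hq hqS ↦ complexGysin_baseChange_of_commonSection complexOrientationFamily hE hX hS π σ hσπ φ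
      (φ ≫ diagonalAut (fermatPolynomial ℂ (2 * (0 + s + 1)) m) (fermatGroup_le_diagonalStabilizer m q.2))
      (by omega) (hinc q hq hqS) hdeg0 (by rw [hone q]; exact h1)
  -- all these `K` coincide with the `K₀` of `φ^*(φ_* 1) = K₀ • σ_* 1`
  have hKuniq : ∀ {K : ℂ} (q : fermatGroup (2 * (0 + s + 1)) m),
      (∀ ⦃a b : ℕ⦄ (hab : a + 2 * (2 * (0 + s + 1)) = b + 2 * (2 * s + 1))
        (w' : complexBetti (fermatHypersurface (2 * s) m) a),
        complexBetti.map φ b (complexGysin complexOrientationFamily hE hX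
            (φ ≫ diagonalAut (fermatPolynomial ℂ (2 * (0 + s + 1)) m)
              (fermatGroup_le_diagonalStabilizer m q.2)) hab (complexBetti.map π a w')) =
          K • complexGysin complexOrientationFamily hS hE σ
            (show a + 2 * (2 * s + 1) = b + 2 * (2 * s) by omega) w') →
      complexBetti.map φ 2 (complexGysin complexOrientationFamily hE hX φ hdeg0
          (singularCohomology.one ℂ (ComplexPoints E))) =
        K • complexGysin complexOrientationFamily hS hE σ
          (show 0 + 2 * (2 * s + 1) = 2 + 2 * (2 * s) by omega)
          (singularCohomology.one ℂ (ComplexPoints (fermatHypersurface (2 * s) m))) := by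
    intro K q hKq
    have h := hKq hdeg0 (singularCohomology.one ℂ (ComplexPoints (fermatHypersurface (2 * s) m)))
    rw [show complexBetti.map π 0 (singularCohomology.one ℂ (ComplexPoints (fermatHypersurface (2 * s) m))) =
        singularCohomology.one ℂ (ComplexPoints E) from singularCohomology.map_one _, hone q] at h
    exact h
  -- ## a reference vertex move `q₀ = (1, ζ, 1, …, 1)` and the common scalar `K₀`
  have hζ := Complex.isPrimitiveRoot_exp m (NeZero.ne m)
  set ζ : rootsOfUnity m ℂ := hζ.toRootsOfUnity with hζdef
  have hζu : IsPrimitiveRoot (ζ : ℂˣ) m :=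
    IsPrimitiveRoot.coe_units_iff.mp (by simpa [hζdef] using hζ)
  have hζ1 : ((ζ : ℂˣ)) ≠ 1 := by
    intro h1'
    rw [h1'] at hζu
    have hm1 : m = 1 := hζu.unique IsPrimitiveRoot.one
    haveI : Subsingleton (ZMod m) := (ZMod.subsingleton_iff).mpr hm1
    exact hδ0 (Subsingleton.elim _ _)
  have hq₀0 : ((fermatGroupSingle (embFirst 0 s 1) ζ : fermatGroup (2 * (0 + s + 1)) m) :
      Fin (2 * (0 + s + 1) + 2) → ℂˣ) (embFirst 0 s 0) = 1 :=
    fermatGroupSingle_apply_of_ne' _ _ h01 ζ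
  have hq₀1 : ((fermatGroupSingle (embFirst 0 s 1) ζ : fermatGroup (2 * (0 + s + 1)) m) :
      Fin (2 * (0 + s + 1) + 2) → ℂˣ) (embFirst 0 s 1) = (ζ : ℂˣ) :=
    fermatGroupSingle_apply_self _ ζ
  obtain ⟨K₀, hK₀, hK₀eq⟩ := hK (fermatGroupSingle (embFirst 0 s 1) ζ)
    (by rw [hq₀0, hq₀1]; exact hζ1.symm)
    (fun k ↦ fermatGroupSingle_apply_of_ne' _ _
      (FermatCharacter.embFirst_ne_embSecond (r := 0) 1 k).symm ζ)
  have hKeq : ∀ {K : ℂ} (q : fermatGroup (2 * (0 + s + 1)) m),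
      (∀ ⦃a b : ℕ⦄ (hab : a + 2 * (2 * (0 + s + 1)) = b + 2 * (2 * s + 1))
        (w' : complexBetti (fermatHypersurface (2 * s) m) a),
        complexBetti.map φ b (complexGysin complexOrientationFamily hE hX
            (φ ≫ diagonalAut (fermatPolynomial ℂ (2 * (0 + s + 1)) m)
              (fermatGroup_le_diagonalStabilizer m q.2)) hab (complexBetti.map π a w')) =
          K • complexGysin complexOrientationFamily hS hE σ
            (show a + 2 * (2 * s + 1) = b + 2 * (2 * s) by omega) w') → K = K₀ := by
    intro K q hKq
    have h := (hKuniq q hKq).symm.trans (hKuniq _ hK₀eq)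
    rw [← sub_eq_zero, ← sub_smul, smul_eq_zero] at h
    exact sub_eq_zero.mp (h.resolve_right hσ1)
  -- ## the class `x = φ_* π^* w` is a `χ_{0∗β}`-eigenvector of the stabiliser
  have hstab' : ∀ a : fermatGroup (2 * (0 + s + 1)) m,
      (a : Fin (2 * (0 + s + 1) + 2) → ℂˣ) (embFirst 0 s 0) =
        (a : Fin (2 * (0 + s + 1) + 2) → ℂˣ) (embFirst 0 s 1) →
      singularCohomology.map ℂ ℂ (diagonalMap (fermatPolynomial ℂ (2 * (0 + s + 1)) m)
          (fermatGroup_le_diagonalStabilizer m a.2)) (2 * (0 + s + 1))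
          (complexGysin complexOrientationFamily hE hX φ hdegφ (complexBetti.map π (2 * s) w)) =
        ((fermatCharacter m (append (0 : Fin (2 * 0 + 2) → ZMod m) β) a : ℂˣ) : ℂ) •
          complexGysin complexOrientationFamily hE hX φ hdegφ (complexBetti.map π (2 * s) w) := by
    intro a ha
    obtain ⟨g, g', hgg', hg'g, hgφ, hgπ⟩ := hstab a ha
    have ha' := fermatGroup_le_diagonalStabilizer m a.2
    rw [map_diagonalMap_complexGysin _ hX ha' hE φ hdegφ]
    have hφ' : φ ≫ diagonalAut (fermatPolynomial ℂ (2 * (0 + s + 1)) m) (inv_mem ha') = g' ≫ φ := by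
      have hid : g' ≫ g ≫ φ = φ := by rw [← Category.assoc, hg'g, Category.id_comp]
      calc φ ≫ diagonalAut (fermatPolynomial ℂ (2 * (0 + s + 1)) m) (inv_mem ha')
          = (g' ≫ g ≫ φ) ≫ diagonalAut (fermatPolynomial ℂ (2 * (0 + s + 1)) m) (inv_mem ha') := by
            rw [hid]
        _ = g' ≫ (g ≫ φ) ≫ diagonalAut (fermatPolynomial ℂ (2 * (0 + s + 1)) m) (inv_mem ha') := by
            simp only [Category.assoc]
        _ = g' ≫ (φ ≫ diagonalAut (fermatPolynomial ℂ (2 * (0 + s + 1)) m) ha') ≫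
              diagonalAut (fermatPolynomial ℂ (2 * (0 + s + 1)) m) (inv_mem ha') := by rw [hgφ]
        _ = g' ≫ φ := by rw [Category.assoc, diagonalAut_comp_inv, Category.comp_id]
    rw [hφ', complexGysin_comp hμ hE hE hX g' φ (rfl : 2 * s + 2 * (2 * s + 1) = 2 * s + 2 * (2 * s + 1))
      hdegφ, LinearMap.comp_apply]
    -- `g'_* = g^*` for the automorphism `g'` with inverse `g`
    haveI : IsIso g'.left :=
      ⟨⟨g.left, by rw [← Over.comp_left, hg'g, Over.id_left], by rw [← Over.comp_left, hgg', Over.id_left]⟩⟩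
    have hbir : Resolution.IsBirational g'.left := by
      refine ⟨⊤, dense_univ, ?_, ?_⟩
      · rw [Scheme.Hom.preimage_top]
        exact dense_univ
      · exact IsZariskiLocalAtTarget.restrict (P := MorphismProperty.isomorphisms Scheme)
          (show IsIso g'.left from inferInstance) ⊤
    rw [← complexBetti_map_eq_complexGysin_of_comp_eq_id hE hE g' g hg'g hbir]
    -- `g^* π^* w = π^* g_{a|S}^* w = χ_β(a|S) • π^* w`
    rw [← CategoryTheory.comp_apply (complexBetti.map π (2 * s)) (complexBetti.map g (2 * s)),
      ← complexBetti.map_comp, hgπ, complexBetti.map_comp, CategoryTheory.comp_apply]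
    have hwb := (mem_fermatEigenspace_iff.mp hwV) ⟨_, comp_embSecond_mem_fermatGroup a⟩
    change complexGysin complexOrientationFamily hE hX φ hdegφ (complexBetti.map π (2 * s)
      (singularCohomology.map ℂ ℂ (diagonalMap (fermatPolynomial ℂ (2 * s) m)
        (fermatGroup_le_diagonalStabilizer m (comp_embSecond_mem_fermatGroup a))) (2 * s) w)) = _
    rw [hwb, map_smul, map_smul, fermatCharacter_append_zero]
  -- ## off the stabiliser: `φ^*(g_a^* x) = χ_{0∗β}(a) K₀ • σ_* w`
  have hoff' : ∀ a : fermatGroup (2 * (0 + s + 1)) m,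
      (a : Fin (2 * (0 + s + 1) + 2) → ℂˣ) (embFirst 0 s 0) ≠
        (a : Fin (2 * (0 + s + 1) + 2) → ℂˣ) (embFirst 0 s 1) →
      complexBetti.map φ (2 * (0 + s + 1))
          (singularCohomology.map ℂ ℂ (diagonalMap (fermatPolynomial ℂ (2 * (0 + s + 1)) m)
            (fermatGroup_le_diagonalStabilizer m a.2)) (2 * (0 + s + 1))
            (complexGysin complexOrientationFamily hE hX φ hdegφ (complexBetti.map π (2 * s) w))) =
        (((fermatCharacter m (append (0 : Fin (2 * 0 + 2) → ZMod m) β) a : ℂˣ) : ℂ) * K₀) •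
          complexGysin complexOrientationFamily hS hE σ hdegσ w := by
    intro a ha
    -- the ratio `u = a₁/a₀ ≠ 1`, an `m`-th root of unity, and the pure move `p = (1, u, 1, …, 1)`
    set u : ℂˣ := (a : Fin (2 * (0 + s + 1) + 2) → ℂˣ) (embFirst 0 s 1) *
      ((a : Fin (2 * (0 + s + 1) + 2) → ℂˣ) (embFirst 0 s 0))⁻¹ with hu
    have hum : u ∈ rootsOfUnity m ℂ := by
      rw [mem_rootsOfUnity, hu, mul_pow, inv_pow, mem_fermatGroup_iff.mp a.2, mem_fermatGroup_iff.mp a.2,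
        inv_one, mul_one]
    have hu1 : u ≠ 1 := by
      intro h
      apply ha
      rw [hu, mul_inv_eq_one] at h
      exact h.symm
    set p : fermatGroup (2 * (0 + s + 1)) m := fermatGroupSingle (embFirst 0 s 1) ⟨u, hum⟩ with hp
    have hp0 : (p : Fin (2 * (0 + s + 1) + 2) → ℂˣ) (embFirst 0 s 0) = 1 :=
      fermatGroupSingle_apply_of_ne' _ _ h01 _
    have hp1 : (p : Fin (2 * (0 + s + 1) + 2) → ℂˣ) (embFirst 0 s 1) = u :=
      fermatGroupSingle_apply_self _ _
    have hpS : ∀ k, (p : Fin (2 * (0 + s + 1) + 2) → ℂˣ) (embSecond 0 s k) = 1 := fun k ↦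
      fermatGroupSingle_apply_of_ne' _ _ (FermatCharacter.embFirst_ne_embSecond (r := 0) 1 k).symm _
    -- `a = (a p⁻¹) p` with `a p⁻¹` in the stabiliser
    have has : ((a * p⁻¹ : fermatGroup (2 * (0 + s + 1)) m) : Fin (2 * (0 + s + 1) + 2) → ℂˣ)
        (embFirst 0 s 0) = ((a * p⁻¹ : fermatGroup (2 * (0 + s + 1)) m) : Fin (2 * (0 + s + 1) + 2) → ℂˣ)
        (embFirst 0 s 1) := by
      change (a : Fin (2 * (0 + s + 1) + 2) → ℂˣ) (embFirst 0 s 0) *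
          ((p : Fin (2 * (0 + s + 1) + 2) → ℂˣ) (embFirst 0 s 0))⁻¹ =
        (a : Fin (2 * (0 + s + 1) + 2) → ℂˣ) (embFirst 0 s 1) *
          ((p : Fin (2 * (0 + s + 1) + 2) → ℂˣ) (embFirst 0 s 1))⁻¹
      rw [hp0, hp1, hu, inv_one, mul_one, mul_inv_rev, inv_inv, mul_left_comm, mul_inv_cancel, mul_one]
    have hap : ((a * p⁻¹ * p : fermatGroup (2 * (0 + s + 1)) m) : Fin (2 * (0 + s + 1) + 2) → ℂˣ) =
        (a : Fin (2 * (0 + s + 1) + 2) → ℂˣ) := by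
      rw [inv_mul_cancel_right]
    rw [← diagonalMap_congr hap (fermatGroup_le_diagonalStabilizer m (a * p⁻¹ * p).2)
      (fermatGroup_le_diagonalStabilizer m a.2)]
    rw [show diagonalMap (fermatPolynomial ℂ (2 * (0 + s + 1)) m)
        (fermatGroup_le_diagonalStabilizer m (a * p⁻¹ * p).2) =
        (diagonalMap (fermatPolynomial ℂ (2 * (0 + s + 1)) m)
          (fermatGroup_le_diagonalStabilizer m (a * p⁻¹).2)).comp
        (diagonalMap (fermatPolynomial ℂ (2 * (0 + s + 1)) m) (fermatGroup_le_diagonalStabilizer m p.2))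
        from diagonalMap_mul _ _]
    rw [← singularCohomology.map_map, hstab' (a * p⁻¹) has, map_smul,
      map_diagonalMap_complexGysin _ hX (fermatGroup_le_diagonalStabilizer m p.2) hE φ hdegφ, map_smul]
    -- the clean base change for the move `p⁻¹`
    have hpi0 : ((p⁻¹ : fermatGroup (2 * (0 + s + 1)) m) : Fin (2 * (0 + s + 1) + 2) → ℂˣ) (embFirst 0 s 0) ≠
        ((p⁻¹ : fermatGroup (2 * (0 + s + 1)) m) : Fin (2 * (0 + s + 1) + 2) → ℂˣ) (embFirst 0 s 1) := by
      change ((p : Fin (2 * (0 + s + 1) + 2) → ℂˣ) (embFirst 0 s 0))⁻¹ ≠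
        ((p : Fin (2 * (0 + s + 1) + 2) → ℂˣ) (embFirst 0 s 1))⁻¹
      rw [hp0, hp1, inv_one, ne_eq, eq_inv_iff_mul_eq_one, one_mul]
      exact hu1
    have hpiS : ∀ k, ((p⁻¹ : fermatGroup (2 * (0 + s + 1)) m) : Fin (2 * (0 + s + 1) + 2) → ℂˣ)
        (embSecond 0 s k) = 1 := fun k ↦ by
      change ((p : Fin (2 * (0 + s + 1) + 2) → ℂˣ) (embSecond 0 s k))⁻¹ = 1
      rw [hpS k, inv_one]
    obtain ⟨K, -, hKq⟩ := hK (p⁻¹) hpi0 hpiS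
    have hKK₀ : K = K₀ := hKeq (p⁻¹) hKq
    have h := hKq hdegφ w
    rw [hKK₀] at h
    change complexBetti.map φ (2 * (0 + s + 1)) (complexGysin complexOrientationFamily hE hX
        (φ ≫ diagonalAut (fermatPolynomial ℂ (2 * (0 + s + 1)) m)
          (fermatGroup_le_diagonalStabilizer m (p⁻¹).2)) hdegφ (complexBetti.map π (2 * s) w)) = _ at h
    rw [h, smul_smul]
    -- the character: `χ_{0∗β}(a p⁻¹) = χ_{0∗β}(a)`
    congr 1
    rw [map_mul, map_inv, fermatCharacter_fermatGroupSingle, hδ'1, ZMod.val_zero, pow_zero, inv_one, mul_one]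
  -- ## conclusion: the criterion without self-term
  exact fermatProjector_ne_zero_of_offStabilizer_restrictions (r := 0 + s + 1) (by omega)
    (append α β) (append (0 : Fin (2 * 0 + 2) → ZMod m) β) h01 hδ0 hsum hδ'0 hδ'1 hδ'j hδ'ne _
    (complexBetti.map φ (2 * (0 + s + 1))).hom hA hK₀ hstab' hoff'

/-- **The cone-span leaf (III-l) `Shioda1979_coneSpan_represents_left` from cone data.** If for every
`m ≥ 1`, `s ≥ 1` there is a cone datum over the sub-Fermat variety `X²ˢₘ ⊂ X^{2(0+s+1)}ₘ` — a smooth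
projective `(2s+1)`-fold `E`, a flat `π : E ⟶ X²ˢₘ` with a closed-immersion section `σ`, and
`φ : E ⟶ X^{2(0+s+1)}ₘ` with (stab), (inc), (h1) of `coneSpan_represents_of_coneDatum` (in print:
`E = ℙ(O ⊕ O(1))` the blow-up of the cone `{x₁ = ε x₀} ∩ X` at its vertex, `σ` the base, `φ` the
blow-down) — then the named leaf (III-l) of Aoki's Thm. 1-4 (i) holds (with the complex orientations).
Residual obligation of `Shioda1979_coneSpan_represents_left` on this road: exactly the cone data.
[cite: Aoki1987, Thm. 1-4 (i) p. 388 and p. 386] [cite: daSilva2021HodgeFermat, Thm. 2.2 (b)]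
[cite: Shioda1979HodgeFermat, Thm. I] -/
theorem Shioda1979_coneSpan_represents_left_of_coneData
    (hdata : ∀ (m s : ℕ) [NeZero m], 1 ≤ s →
      ∃ (E : SchemeOver ℂ) (hE : IsSmoothProjective (2 * s + 1) E)
        (π : E ⟶ fermatHypersurface (2 * s) m) (_ : Flat π.left)
        (σ : fermatHypersurface (2 * s) m ⟶ E) (_ : σ ≫ π = 𝟙 _) (_ : IsClosedImmersion σ.left)
        (φ : E ⟶ fermatHypersurface (2 * (0 + s + 1)) m),
        (∀ a : fermatGroup (2 * (0 + s + 1)) m,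
          (a : Fin (2 * (0 + s + 1) + 2) → ℂˣ) (embFirst 0 s 0) =
            (a : Fin (2 * (0 + s + 1) + 2) → ℂˣ) (embFirst 0 s 1) →
          ∃ g g' : E ⟶ E, g ≫ g' = 𝟙 E ∧ g' ≫ g = 𝟙 E ∧
            g ≫ φ = φ ≫ diagonalAut (fermatPolynomial ℂ (2 * (0 + s + 1)) m)
              (fermatGroup_le_diagonalStabilizer m a.2) ∧
            g ≫ π = π ≫ diagonalAut (fermatPolynomial ℂ (2 * s) m)
              (fermatGroup_le_diagonalStabilizer m (comp_embSecond_mem_fermatGroup a))) ∧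
        (∀ a : fermatGroup (2 * (0 + s + 1)) m,
          (a : Fin (2 * (0 + s + 1) + 2) → ℂˣ) (embFirst 0 s 0) ≠
            (a : Fin (2 * (0 + s + 1) + 2) → ℂˣ) (embFirst 0 s 1) →
          (∀ k, (a : Fin (2 * (0 + s + 1) + 2) → ℂˣ) (embSecond 0 s k) = 1) →
          ∀ P Q : ComplexPoints E,
            AlgPoints.map (φ ≫ diagonalAut (fermatPolynomial ℂ (2 * (0 + s + 1)) m)
              (fermatGroup_le_diagonalStabilizer m a.2)) P = AlgPoints.map φ Q →
            ∃ R : ComplexPoints (fermatHypersurface (2 * s) m),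
              AlgPoints.map σ R = P ∧ AlgPoints.map σ R = Q) ∧
        complexBetti.map φ 2 (complexGysin complexOrientationFamily hE
          (isSmoothProjective_fermatHypersurface (n := 2 * (0 + s + 1)) (by omega) NeZero.one_le) φ
          (show 0 + 2 * (2 * (0 + s + 1)) = 2 + 2 * (2 * s + 1) by omega)
          (singularCohomology.one ℂ (ComplexPoints E))) ≠ 0) :
    Shioda1979_coneSpan_represents_left := by
  intro m s _ α β hs hα hβ
  obtain ⟨E, hE, π, hπ, σ, hσπ, hσ, φ, hstab, hinc, h1⟩ := hdata m s hs
  haveI := hπ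
  haveI := hσ
  have hX : IsSmoothProjective (2 * (0 + s + 1)) (fermatHypersurface (2 * (0 + s + 1)) m) :=
    isSmoothProjective_fermatHypersurface (by omega) NeZero.one_le
  obtain ⟨w, hw, hne⟩ := coneSpan_represents_of_coneDatum hs hE hX π σ hσπ φ hstab hinc h1 hα hβ
  exact ⟨complexOrientationFamily, 2 * s + 1, E, hE, hX, π, hπ, φ, rfl, w, hw, hne⟩

end Literature.AlgebraicGeometry.HodgeTheory

end
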